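import Summits.Schanuel.Schanuel.Theses.RigidCore
import Summits.Schanuel.Schanuel.Theorems.RigidCoreDefs
import Literature.NumberTheory.Transcendental.AxSchanuel
import Literature.NumberTheory.Transcendental.KirbyEDerivations
import Literature.NumberTheory.Transcendental.AxDerivationTools
import Literature.Barriers.Schanuel.LargeTranscendenceDegree

/-!
# Sketch (crux-ideate stmt-Schanuel-0970, round 2, ideator 5): the second exponential / torsion split

Signatures for the idea card `second-exponential-torsion-split` of crux
`Summit.Schanuel.Schanuel.Theses.RigidCore.SchanuelOnLogFreeCore` ((R): Schanuel on the log-free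
core `C_EA = eaFibre (2πi)`). Definitions and statements only (`Prop`s), plus three cheap sanity
theorems (non-vacuity of the new objects). Nothing here is a route item.
-/

noncomputable section

set_option linter.dupNamespace false

namespace Summit.Schanuel.Schanuel.Cruxes.SchanuelOnLogFreeCore.SecondExponential

open Complex IntermediateField
open Summit.Schanuel.Schanuel.Theses.RigidCore (SchanuelOnLogFreeCore)
open Summit.Schanuel.Schanuel.Theorems.RigidCore (eaFibre kernelFreeCore exp_mem_eaFibre
  mem_eaFibre_self mem_eaFibre_of_isAlgebraic)
open Literature.NumberTheory.Transcendental (IsEDerivation constantSubring)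

/-! ## 1. The kernel-preserving deformation `exp ↦ (z ↦ e^{cz})` and Theorem G -/

/-- `ℚ(x, e^{c x})`: the Schanuel field of a tuple for the scaled exponential `z ↦ e^{cz}`. -/
abbrev scaledSchanuelField (c : ℂ) {n : ℕ} (x : Fin n → ℂ) : IntermediateField ℚ ℂ :=
  adjoin ℚ (Set.range x ∪ Set.range (fun i => cexp (c * x i)))

/-- Schanuel's statement at rank `n` for the scaled exponential `z ↦ e^{cz}` (all tuples of `ℂ`). -/
def ScaledSchanuelRank (c : ℂ) (n : ℕ) : Prop :=
  ∀ x : Fin n → ℂ, LinearIndependent ℚ x →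
    (n : Cardinal) ≤ Algebra.trdeg ℚ ↥(scaledSchanuelField c x)

/-- At `c = 1` the generating set is that of `SchanuelRank n` (sanity; the `trdeg` statements then
agree, but rewriting under `Algebra.trdeg` is blocked by the dependent instance, so only the set
identity is recorded). -/
theorem scaledSchanuelField_one {n : ℕ} (x : Fin n → ℂ) :
    scaledSchanuelField 1 x = adjoin ℚ (Set.range x ∪ Set.range (cexp ∘ x)) := by
  simp [scaledSchanuelField, Function.comp_def]

/-- **FIRST LEMMA (Theorem G, ranks ≤ 2).** For every E-derivation `D` of `ℂ_exp` and every
`c` with `D c ≠ 0` (a `D`-generic scaling), Schanuel's statement holds for the exponential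
`z ↦ e^{cz}` at ranks `1` and `2`, for ALL tuples of `ℂ`. Proof route: Ax (`ax_schanuel_holds`) at
the tuple `c • x` split along `ker D`, plus Gel'fond–Schneider (`gelfond_schneider_holds`) for the
`≤ 2` constant directions; ~400 lines, no term calculus. -/
def GenericScalingRankTwo : Prop :=
  ∀ (D : Derivation ℤ ℂ ℂ), IsEDerivation D → ∀ c : ℂ, D c ≠ 0 →
    ScaledSchanuelRank c 1 ∧ ScaledSchanuelRank c 2

/-- **Theorem G, general form.** Same conclusion at every rank `n`, for tuples `x` whose scaled
span `span_ℚ (c • x)` meets the constants of `D` in dimension `≤ 2` (the residue for `≥ 3`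
constant directions is the projective Gel'fond–Schneider statement `GSProjective` below). -/
def GenericScaling : Prop :=
  ∀ (D : Derivation ℤ ℂ ℂ), IsEDerivation D → ∀ c : ℂ, D c ≠ 0 →
    ∀ (n : ℕ) (x : Fin n → ℂ), LinearIndependent ℚ x →
      Module.finrank ℚ ↥(Submodule.span ℚ (Set.range (fun i => c * x i)) ⊓
          Submodule.span ℚ ((constantSubring ![D] : Subring ℂ) : Set ℂ)) ≤ 2 →
        (n : Cardinal) ≤ Algebra.trdeg ℚ ↥(scaledSchanuelField c x)

/-- The residue of Theorem G at `k ≥ 3` constant directions: for `v₁, …, v_k` `ℚ`-linearly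
independent constants of `D` (so `e^{vⱼ}` and the ratios `vⱼ/v₁` are constants too),
`trdeg ℚ(v₂/v₁, …, v_k/v₁, e^{v₁}, …, e^{v_k}) ≥ k − 1` ("projective Schanuel on the constants";
true for `k ≤ 2` by Gel'fond–Schneider, open from `k = 3`: e.g. `(2πi, 2πi√2, 2πi√3)`). -/
def GSProjective (D : Derivation ℤ ℂ ℂ) : Prop :=
  ∀ (k : ℕ) (v : Fin (k + 1) → ℂ), (∀ j, D (v j) = 0) → LinearIndependent ℚ v →
    (k : Cardinal) ≤ Algebra.trdeg ℚ
      ↥(adjoin ℚ (Set.range (fun j : Fin (k + 1) => v j / v 0) ∪ Set.range (cexp ∘ v)))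

/-! ### Toy case of Theorem G, kernel-checked: rank 1

The mechanism in its smallest instance: an E-derivation `D` with `D c ≠ 0` moves `c·x₀` for every
non-zero ALGEBRAIC `x₀` (it kills `x₀`), hence moves `e^{c x₀}`, which is therefore transcendental;
a transcendental `x₀` needs nothing. So `ScaledSchanuelRank c 1` holds at every `D`-generic `c`. -/

section ToyRankOne

open Literature.NumberTheory.Transcendental (eDer dcl dclSubfield derivation_eq_zero_of_isAlgebraic)

/-- An E-derivation of `ℂ` kills the rationals (they lie in the subfield `dcl ∅`). -/
theorem eDerivation_ratCast {D : Derivation ℤ ℂ ℂ} (hD : IsEDerivation D) (q : ℚ) :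
    D (algebraMap ℚ ℂ q) = 0 := by
  have hmem : (algebraMap ℚ ℂ q : ℂ) ∈ dclSubfield ℂ (∅ : Set ℂ) := by
    rw [eq_ratCast]
    exact SubfieldClass.ratCast_mem _ q
  exact hmem D ⟨hD, fun c hc => hc.elim⟩

/-- An E-derivation of `ℂ` kills every algebraic number. -/
theorem eDerivation_eq_zero_of_isAlgebraic {D : Derivation ℤ ℂ ℂ} (hD : IsEDerivation D) {a : ℂ}
    (ha : IsAlgebraic ℚ a) : D a = 0 :=
  derivation_eq_zero_of_isAlgebraic (F := ℚ) D (eDerivation_ratCast hD) ha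

/-- An algebraically independent family inside an intermediate field bounds its transcendence
degree from below (verbatim from the crux's `Disproof.lean`). -/
theorem natCast_le_trdeg_of_algebraicIndependent {n : ℕ} {L : IntermediateField ℚ ℂ}
    (y : Fin n → ℂ) (hy : AlgebraicIndependent ℚ y) (hmem : ∀ i, y i ∈ L) :
    (n : Cardinal) ≤ Algebra.trdeg ℚ L := by
  let y' : Fin n → L := fun i => ⟨y i, hmem i⟩
  have hy' : AlgebraicIndependent ℚ y' :=
    AlgebraicIndependent.of_comp L.val (by exact hy)
  simpa using hy'.cardinalMk_le_trdeg

/-- A transcendental element of an intermediate field forces `trdeg ≥ 1`. -/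
theorem one_le_trdeg_of_mem_of_transcendental {L : IntermediateField ℚ ℂ} {w : ℂ} (hw : w ∈ L)
    (ht : Transcendental ℚ w) : (1 : Cardinal) ≤ Algebra.trdeg ℚ L := by
  have h := natCast_le_trdeg_of_algebraicIndependent ![w]
    (algebraicIndependent_iff_transcendental.mpr (by simpa using ht)) (fun i => by simpa using hw)
  simpa using h

/-- **Theorem G at rank 1 (proved).** For an E-derivation `D` of `ℂ_exp` and `c` with `D c ≠ 0`,
Schanuel's statement at rank `1` holds for `z ↦ e^{cz}`: for every `x₀ ≠ 0`,
`trdeg ℚ(x₀, e^{c x₀}) ≥ 1`. -/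
theorem scaledSchanuelRank_one {D : Derivation ℤ ℂ ℂ} (hD : IsEDerivation D) {c : ℂ}
    (hc : D c ≠ 0) : ScaledSchanuelRank c 1 := by
  intro x hx
  have hx0 : x 0 ≠ 0 := hx.ne_zero 0
  have hmem_x : x 0 ∈ scaledSchanuelField c x := subset_adjoin ℚ _ (Or.inl ⟨0, rfl⟩)
  have hmem_e : cexp (c * x 0) ∈ scaledSchanuelField c x := subset_adjoin ℚ _ (Or.inr ⟨0, rfl⟩)
  by_cases halg : IsAlgebraic ℚ (x 0)
  · -- `e^{c x₀}` is moved by `D`, hence transcendental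
    refine (one_le_trdeg_of_mem_of_transcendental hmem_e ?_).trans_eq (by simp)
    intro hexp
    have h1 : D (cexp (c * x 0)) = 0 := eDerivation_eq_zero_of_isAlgebraic hD hexp
    have h2 : D (cexp (c * x 0)) = cexp (c * x 0) * D (c * x 0) := hD (c * x 0)
    have h3 : D (c * x 0) = x 0 * D c := by
      rw [Derivation.leibniz, eDerivation_eq_zero_of_isAlgebraic hD halg, smul_zero, zero_add,
        smul_eq_mul]
    rw [h2, h3] at h1
    rcases mul_eq_zero.1 h1 with h | h
    · exact Complex.exp_ne_zero _ h
    · rcases mul_eq_zero.1 h with h' | h'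
      · exact hx0 h'
      · exact hc h'
  · -- `x₀` itself is transcendental
    exact (one_le_trdeg_of_mem_of_transcendental hmem_x halg).trans_eq (by simp)

end ToyRankOne

/-! ## 2. The second exponential `e(z) = exp(2πi z)` on the core and the scaled cores -/

/-- The **e-core** `𝔈 = ℚ^{eA}`: smallest relatively algebraically closed subfield of `ℂ` closed
under the normalised exponential `w ↦ e^{2πi w}` (Gel'fond–Schneider / CM values: `i`, `1^β`,
`e^{-2π}`, `e^{2πi e^{-2π}}`, …). Dual to Macintyre's `kernelFreeCore = ℚ^{EA}`. -/
def eCore : IntermediateField ℚ ℂ :=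
  sInf {K : IntermediateField ℚ ℂ | (∀ w ∈ K, cexp (2 * ↑Real.pi * I * w) ∈ K) ∧
    ∀ w : ℂ, IsAlgebraic K w → w ∈ K}

/-- The log-free core of the scaled exponential field `(ℂ, z ↦ e^{cz})`: smallest relatively
algebraically closed subfield containing its period `2πi/c` and closed under `w ↦ e^{cw}`.
`scaledCore 1 = eaFibre (2πi) = C_EA`. -/
def scaledCore (c : ℂ) : IntermediateField ℚ ℂ :=
  sInf {K : IntermediateField ℚ ℂ | (2 * ↑Real.pi * I / c : ℂ) ∈ K ∧ (∀ w ∈ K, cexp (c * w) ∈ K) ∧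
    ∀ w : ℂ, IsAlgebraic K w → w ∈ K}

/-- Sanity: `𝔈 ≤ C_EA` (the core is `e`-closed because `2πi ∈ C_EA` and it is `exp`-closed). -/
theorem eCore_le_core : eCore ≤ eaFibre (2 * ↑Real.pi * I) := by
  refine sInf_le ⟨fun w hw => ?_, fun w hw => mem_eaFibre_of_isAlgebraic hw⟩
  exact exp_mem_eaFibre (mul_mem (mem_eaFibre_self _) hw)

/-- Sanity / the invariance behind the card: `𝔈 ≤ scaledCore c` for every `c ≠ 0` — the
Gel'fond–Schneider values are common to ALL the scaled cores (the deformation fixes them). -/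
theorem eCore_le_scaledCore {c : ℂ} (hc : c ≠ 0) : eCore ≤ scaledCore c := by
  refine le_sInf fun K hK => sInf_le ⟨fun w hw => ?_, hK.2.2⟩
  have h := hK.2.1 _ (mul_mem hK.1 hw)
  convert h using 2
  field_simp

/-- Statement: for algebraic `c ≠ 0` the scaled core IS the log-free core and the scaled Schanuel
statement on it is (R) itself — the jump locus of the family meets `ℚ̄ˣ` in `∅` or in everything. -/
def ScaledCoreOfAlgebraic : Prop :=
  ∀ c : ℂ, IsAlgebraic ℚ c → c ≠ 0 → scaledCore c = eaFibre (2 * ↑Real.pi * I)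

/-- (R_c): Schanuel for `z ↦ e^{cz}` on its own log-free core. `CoreScaledSchanuel 1 ↔ (R)`. -/
def CoreScaledSchanuel (c : ℂ) : Prop :=
  ∀ (n : ℕ) (x : Fin n → ℂ), (∀ i, x i ∈ scaledCore c) → LinearIndependent ℚ x →
    (n : Cardinal) ≤ Algebra.trdeg ℚ ↥(scaledSchanuelField c x)

/-! ## 3. The torsion split (the Transfer) -/

/-- The torsion directions `ℚ̄ · 2πi` (the `ℚ`-span of the algebraic multiples of the period):
the arguments whose scaled exponentials `e^{c · (β·2πi/c)} = 1^β` do not move with `c`. -/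
def torsionDirections : Submodule ℚ ℂ :=
  Submodule.span ℚ {z | ∃ β : ℂ, IsAlgebraic ℚ β ∧ z = β * (2 * ↑Real.pi * I)}

/-- The torsion-value field `T`: relative algebraic closure in `ℂ` of `ℚ(ℚ̄·2πi ∪ exp(ℚ̄·2πi))`
= `ℚ(π, 1^β : β ∈ ℚ̄)^{alg} ∩ ℂ`. -/
def torsionValueField : IntermediateField ℚ ℂ :=
  sInf {K : IntermediateField ℚ ℂ | (torsionDirections : Set ℂ) ⊆ K ∧
    (∀ w ∈ torsionDirections, cexp w ∈ K) ∧ ∀ w : ℂ, IsAlgebraic K w → w ∈ K}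

/-- **GSπ** — (R) restricted to tuples of torsion directions: for algebraic `β₁, …, βₙ`
`ℚ`-linearly independent, `trdeg ℚ(2πiβ, e^{2πiβ}) ≥ n`, i.e. `π, 1^{β₂/…}` … : "π against the
Gel'fond–Schneider values of the kernel". Proved: `n = 1`; `n = 2` at CM directions (Nesterenko)
and at `(β, β²)` cubic (Gel'fond 1949, exact thanks to `e^{iπ} = -1`); open: real quadratic
direction `(1, √2)`, two CM moduli, `(1, β, β²)`. -/
def GSPi : Prop :=
  ∀ (n : ℕ) (β : Fin n → ℂ), (∀ i, IsAlgebraic ℚ (β i)) → LinearIndependent ℚ β →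
    (n : Cardinal) ≤ Algebra.trdeg ℚ ↥(adjoin ℚ
      (Set.range (fun i => β i * (2 * ↑Real.pi * I)) ∪
        Set.range (fun i => cexp (β i * (2 * ↑Real.pi * I)))))

/-- **Rel_T** — relative Schanuel of the log-free core over the torsion-value field, for core
tuples `ℚ`-linearly independent modulo the torsion directions (the kernel-fibre shadow of
Theorem G: its analogue over `z ↦ e^{cz}`, `D c ≠ 0`, is `GenericScaling`). -/
def RelTorsion : Prop :=
  ∀ (n : ℕ) (x : Fin n → ℂ), (∀ i, x i ∈ eaFibre (2 * ↑Real.pi * I)) →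
    LinearIndependent ℚ (torsionDirections.mkQ ∘ x) →
      (n : Cardinal) ≤ Algebra.trdeg ↥torsionValueField
        ↥(adjoin ↥torsionValueField (Set.range x ∪ Set.range (cexp ∘ x)))

/-- **The Transfer is exact**: `(R) ↔ GSπ ∧ Rel_T` (adapted basis of `span x ∩ ℚ̄·2πi`, tower
law; `→ Rel_T` by the hull count over a tight torsion tuple `2πi(1, β₂, …)`; ~300 lines). -/
def TorsionSplit : Prop := SchanuelOnLogFreeCore ↔ (GSPi ∧ RelTorsion)

/-! ## 4. Instance table: rank-2 instances of (R) provable NOW by the free kernel entry / conjugation -/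

/-- (R) at the Gel'fond ladder pairs `x = (iπβ, iπβ²)`, `β` cubic: `trdeg ≥ 2`, i.e. EXACTLY
Schanuel's bound (from `smallTrdeg_thm_2_9_pos_holds`, `t₁`-clause at `d = ℓ = 3`, the kernel
supplying `e^{iπ·(ℚ-combination)} ∈ ℚ̄` for free). -/
def GelfondLadderPairs : Prop :=
  ∀ β : ℂ, (minpoly ℚ β).natDegree = 3 →
    (2 : Cardinal) ≤ Algebra.trdeg ℚ ↥(adjoin ℚ
      (Set.range ![↑Real.pi * I * β, ↑Real.pi * I * β ^ 2] ∪
        Set.range (cexp ∘ ![↑Real.pi * I * β, ↑Real.pi * I * β ^ 2])))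

/-- (R) at the off-axis pairs `x = (qπi, α)`, `α` algebraic with `Re α ≠ 0 ≠ Im α`:
`trdeg ℚ(π, e^α) = 2` (complex conjugation + Lindemann–Weierstrass at `(α, ᾱ)`). -/
def OffAxisPairs : Prop :=
  ∀ (q : ℚ) (α : ℂ), q ≠ 0 → IsAlgebraic ℚ α → α.re ≠ 0 → α.im ≠ 0 →
    (2 : Cardinal) ≤ Algebra.trdeg ℚ ↥(adjoin ℚ
      (Set.range ![(q : ℂ) * (↑Real.pi * I), α] ∪ Set.range (cexp ∘ ![(q : ℂ) * (↑Real.pi * I), α])))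

/-- The disjunction lemma (Brownawell–Waldschmidt shape, from `smallTrdeg_thm_2_9_two_two`): the two
flagship open instances of (R) cannot BOTH fail in the strong sense — if `e^{π²}` is algebraic then
`e ⊥ π`. -/
def FlagshipDisjunction : Prop :=
  IsAlgebraic ℚ (cexp ((↑Real.pi : ℂ) ^ 2)) → AlgebraicIndependent ℚ ![(Real.pi : ℂ), cexp 1]

end Summit.Schanuel.Schanuel.Cruxes.SchanuelOnLogFreeCore.SecondExponential

end
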